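import Literature.MathematicalPhysics.QuantumFieldTheory.BalabanImbrieJaffe1984to88.BIJ88Eq5145CornerNoncentred
import Literature.MathematicalPhysics.QuantumFieldTheory.BalabanImbrieJaffe1984to88.BIJ88GaussShellModulus309

/-!
# `BalabanImbrieJaffe1984to88.BIJ88Eq5145CornerModulus` — T. Bałaban, J. Imbrie, A. Jaffe, *Effective action and cluster properties of the
abelian Higgs model*, Commun. Math. Phys. **114** (1988) 257–315 [BalabanImbrieJaffe1988]: Sect. 5.14, p. 312 [PDF 56], **(5.14.5) ON THE §5.13
GAUSSIAN MODEL FOR BOTH KINDS OF χ-FACTOR OF p. 308** (rows `C2.Eq5.14.5`, `C2.Eq5.14.1-5.14.2`).  p. 308 [PDF 52]: *"Define z_t(Λ₁₂^{(k)}) for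
t ∈ [0,1] by replacing V(Λ₁₂^{(k)}) with tV(Λ₁₂^{(k)}), replacing χ(cp(e_k), (I−Q^{s*}Q)A^{(k)}) with χ(cp(te_k), (I−Q^{s*}Q)A^{(k)}) and similarly for
χ(cp(e_k), φ^{(k)})"*; (5.2.1)–(5.2.4) p. 278: the restrictions on the complex scalar field are on its MODULUS.  The head theorem of row
`C2.Eq5.14.5` (gen 12's `BIJ88Eq5145CornerNoncentred.eq5145_zG_linear_remR_of_ineq5144'`) takes LINEAR slot fields `hlin` — the components of
`(I − Q^{s*}Q)A^{(k)}` — and so does not cover the `φ^{(k)}`-slots `|φ^{(k)}(x)| = √(Re² + Im²)`.  Gen 12's `BIJ88GaussShellModulus309` proved the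
p. 309 shell sentence and the (5.14.1)–(5.14.2) `t = 0` end for slot fields that are EITHER linear functionals OR moduli of pairs of linear
functionals (`hmod`); here that is carried through p25's (5.14.5) corner assembly: **the (5.14.5) theorems of `BIJ88Eq5145CornerNoncentred` with
`hlin` WEAKENED to `hmod`** — both printed χ-species, any mixture slot by slot, every source `ℱ`, no centring.

statement-level skeleton of published theorems with citation tags; proofs where landed; nothing here is a claim about the Yang–Mills mass gap

PDF held: `paper:balaban1988-cmp114-bij-abelian-higgs-effective-action` (journal page = PDF page + 256); p. 278 = PDF 22, pp. 308–309 = PDF 52–53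
(`p0052.txt` L19–22, `p0053.txt` L25–29), p. 312 = PDF 56 — re-read this generation.

WHAT IS REPRODUCED (unit `lit-balaban-p36`, generation 13 of the Phase-2 proof seat p36, file 1; SKELETON rows **C2.Eq5.14.5** (member) and
**C2.Eq5.14.1-5.14.2** (member) of `HOME/lit-balaban-r16/ROWS-C2-part2.md`, owner r16, heads untouched; HOME `run/shared/lean/pub/lit-balaban/`).
Theorems only (0 definitions, 0 `Prop` facts):
* `isMod_of_isLinearMap` — a linear slot field is a linear-or-modulus slot field (`hlin ⇒ hmod`, second functional `0`), so every theorem below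
  SPECIALISES to its gen-12 `hlin` twin (feeding `isMod_of_isLinearMap hlin` for `hmod` returns the gen-12 statements verbatim; the gate's dedup
  check confirmed the head case `≡ BIJ88Eq5145CornerNoncentred.eq5145_zG_linear_remR_of_ineq5144'`, so no copy is kept here);
* `slotFields_L1_mod_regionLaw` — the p. 309 `L¹` input `hL1` HOLDS for the located slot fields of a region `X` under the law of `X` at the corner
  `1_Λ` (p25's `regionLaw` = `fieldLaw` of the resummed form `Δ_{1_Λ}`), linear-or-modulus slot fields;
* **`eq5145_zG_mod`** — p25's `eq5145_zG_linear` / gen 12's `eq5145_zG_linear'` for `hmod` slot fields: (5.14.5) on the model with (5.13.4), (5.14.1),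
  (5.14.2)-at-`t = 0` (by `BIJ88EffectiveActionNoncentred308.effectiveAction_eq_pertP_add_remR_ursell_of_L1` fed with `slotFields_L1_mod_regionLaw`),
  *"z_F = (z_F/z)·z"*, `z > 0` all by name / proved; displayed per region: a located slot `s₀`, `hrem` (display 4), `h311`;
* **`eq5145_zG_mod_Tsum_of_ineq5144`** — gen 12's `eq5145_zG_linear_Tsum_of_ineq5144'` for `hmod` slot fields (remainder as the display-3
  connected-graph series over the region's virtual supports, modulo the leaf (5.14.4); `BIJ88GaussShellModulus309.…_Tsum_of_ineq5144_mod`);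
* **`eq5145_zG_mod_remR_of_ineq5144`** — THE ROW'S HEAD THEOREM FOR BOTH χ-SPECIES: gen 12's `eq5145_zG_linear_remR_of_ineq5144'` (`ℛ_k(Λ₁₂)`
  itself in the exponent, display 4 read as the definition of the `W₆′` sum) with `hlin` weakened to `hmod`; displayed per region ONLY `s₀`, the
  leaf `h5144` and p. 311 `h311`;
HONEST SCOPE: exactly gen 12's (`BIJ88Eq5145CornerNoncentred`, `BIJ88GaussShellModulus309`): (a) a complex field is carried as two real linear
functionals of the real site field `α → ℝ` (the tree's §5.13 model is real-valued per site); (b) cube-local observables; the IBP structure of `z_F/z`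
not re-derived (Claim@312); (c) (5.14.1) in its ruled admissible reading; (d) `h311` / `h5144` displayed per region, KP regime constants of gen 5;
(e) `(n̄+1)!` slip GAPS G-C2-p36-06; (f) the third species of (5.2.2), `χ_p = χ(e_k p(e_k), |u(p) − 1|)` on the unitary bond variables, is NOT a
slot of the p. 308 `t`-family (p. 308 names only the `(I−Q^{s*}Q)A^{(k)}`- and `φ^{(k)}`-factors) and is not covered.  Imports
`BIJ88Eq5145CornerNoncentred` (p36 g12; hence p25's `BIJ88Eq5145Remainder`/`CornerUrsell`/`CornerModel`) and `BIJ88GaussShellModulus309` (p36 g12);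
modifies nothing.  NOT summit progress; NOT continuum; NOT Clay.  Cell `lit-balaban` Phase 2, seat p36 gen 13 (row owner r16, referee ref-5).
-/

noncomputable section

open Finset MeasureTheory ProbabilityTheory Filter
open scoped Topology
open Literature.Probability.LatticeModels (ursellOf)
open Literature.MathematicalPhysics.QuantumFieldTheory.BalabanImbrieJaffe1984to88.BIJ88DirichletForms305 (interpForm)
open Literature.MathematicalPhysics.QuantumFieldTheory.BalabanImbrieJaffe1984to88.BIJ88PolymerRep5134 (g1 IsAdmissible corner)
open Literature.MathematicalPhysics.QuantumFieldTheory.BalabanImbrieJaffe1984to88.BIJ88PolymerRep5134Gauss (ext prec src expect zG)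
open Literature.MathematicalPhysics.QuantumFieldTheory.BalabanImbrieJaffe1984to88.BIJ88Resummation5141 (outer lam12)
open Literature.MathematicalPhysics.QuantumFieldTheory.BalabanImbrieJaffe1984to88.BIJ88Resummation5141Adm (lam12')
open Literature.MathematicalPhysics.QuantumFieldTheory.BalabanImbrieJaffe1984to88.BIJ88Expansion5143Gauss (fD)
open Literature.MathematicalPhysics.QuantumFieldTheory.BalabanImbrieJaffe1984to88.BIJ88SlotMoments308 (zt slotMoment)
open Literature.MathematicalPhysics.QuantumFieldTheory.BalabanImbrieJaffe1984to88.BIJ88SlotMomentsGauss308 (fieldLaw uD continuous_ext measurable_ext)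
open Literature.MathematicalPhysics.QuantumFieldTheory.BalabanImbrieJaffe1984to88.BIJ88EffectiveActionNoncentred308
  (effectiveAction_eq_pertP_add_remR_ursell_of_L1)
open Literature.MathematicalPhysics.QuantumFieldTheory.BalabanImbrieJaffe1984to88.BIJ88GaussShellModulus309
  (continuous_and_zero_of_mod slotFields_L1_mod effectiveAction_fieldLaw_eq_pertP_add_remR_Tsum_of_ineq5144_mod)
open Literature.MathematicalPhysics.QuantumFieldTheory.BalabanImbrieJaffe1984to88.BIJ88Expansion5143 (g3 prime)
open Literature.MathematicalPhysics.QuantumFieldTheory.BalabanImbrieJaffe1984to88.BIJ88Expansion5143Ordered (polysOf cvsupp locv wv)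
open Literature.MathematicalPhysics.QuantumFieldTheory.BalabanImbrieJaffe1984to88.BIJ88ConnectedGraphResummation (Tsum)
open Literature.MathematicalPhysics.QuantumFieldTheory.BalabanImbrieJaffe1984to88.BIJ88Ineq5113Covering (cubeSys)
open Literature.MathematicalPhysics.QuantumFieldTheory.BalabanImbrieJaffe1984to88.BIJ88Sect5StatementsPart2 (Ineq5144)
open Literature.MathematicalPhysics.QuantumFieldTheory.BalabanImbrieJaffe1984to88.BIJ88Sect2Statements (pLog)
open Literature.MathematicalPhysics.QuantumFieldTheory.BalabanImbrieJaffe1984to88.BIJ88Sect5Statements (CutoffProfile cutoff)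
open Literature.MathematicalPhysics.QuantumFieldTheory.BalabanImbrieJaffe1984to88.BIJ88Sect5StatementsPart4 (remR pertP)
open Literature.MathematicalPhysics.QuantumFieldTheory.BalabanImbrieJaffe1984to88.BIJ88Eq5145CornerModel
open Literature.MathematicalPhysics.QuantumFieldTheory.BalabanImbrieJaffe1984to88.BIJ88Eq5145CornerUrsell (cubeIn cubeIn_mem interpForm_abutting
  ztIn_eq_zG_located)
open Literature.MathematicalPhysics.QuantumFieldTheory.BalabanImbrieJaffe1984to88.BIJ88Eq5145Remainder (sum_add_ite_eq)

namespace Literature.MathematicalPhysics.QuantumFieldTheory.BalabanImbrieJaffe1984to88.BIJ88Eq5145CornerModulus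

/-! ## §0 `hlin ⇒ hmod` -/

section Species

variable {α : Type} {ι : Type*} {B : Finset ι} {Φ : ι → (α → ℝ) → ℝ}

/-- A LINEAR slot field (a component of `(I − Q^{s*}Q)A^{(k)}`, p. 308) is a linear-or-modulus slot field: take the second functional `0` and the
first alternative.  So the `hmod` theorems of this file specialise to their gen-12 `hlin` twins. [cite: BalabanImbrieJaffe1988, (5.14.2) p.308] -/
theorem isMod_of_isLinearMap (hlin : ∀ b ∈ B, IsLinearMap ℝ (Φ b)) :
    ∀ b ∈ B, ∃ ℓ₁ ℓ₂ : (α → ℝ) → ℝ, IsLinearMap ℝ ℓ₁ ∧ IsLinearMap ℝ ℓ₂ ∧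
      ((∀ φ, Φ b φ = ℓ₁ φ) ∨ (∀ φ, Φ b φ = Real.sqrt (ℓ₁ φ ^ 2 + ℓ₂ φ ^ 2))) :=
  fun b hb => ⟨Φ b, fun _ => 0, hlin b hb, ⟨fun _ _ => (add_zero _).symm, fun r _ => (smul_zero r).symm⟩, Or.inl fun _ => rfl⟩

end Species

variable {α I : Type} [Fintype α] [DecidableEq α] [Fintype I] [DecidableEq I]
  (blk : α → I) (Δ : Matrix α α ℝ) (ℱ : α → ℝ)
variable (adj : I → I → Prop) [DecidableRel adj]
variable (χ : CutoffProfile) {ι υ : Type*} [DecidableEq ι] [DecidableEq υ]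
variable {p ek : ℝ} {B : Finset ι} {Φ : ι → (α → ℝ) → ℝ} {c : ι → ℝ} {Ys : Finset υ} {V : υ → (α → ℝ) → ℝ}
variable (cube : ↥B ⊕ ↥Ys → I) {L : Type*} (γ : L → ↥B ⊕ ↥Ys)

/-! ## §1 The p. 309 `L¹` input for the located slot fields of a region -/

omit [DecidableEq ι] [DecidableEq υ] in
/-- **`hL1` FOR THE LOCATED SLOT FIELDS OF A REGION UNDER ITS LAW AT A CORNER, LINEAR-OR-MODULUS SLOT FIELDS** (p. 309: *"After integration over
A^{(k)}, we obtain factors ct^{−n}e^{−cp(te_k)²} … Similar bounds hold for φ^{(k)}"*): for `Δ ≻ 0`, `p > 1/2`, slot fields `Φ_b` each a linear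
functional or a modulus of two linear functionals (`hmod`), `c_b ≥ c₀ > 0`, `e_k > 0`, every region `X`, corner `Λ` and `i ≥ 1`:
`∫ |(∂/∂t)ⁱ Π_{□(b)⊂X} χ(c_b p(te_k), Φ_b(ext ω))| d(regionLaw X Λ)(ω) → 0` as `t → 0⁺` — gen 12's `BIJ88GaussShellModulus309.slotFields_L1_mod` for
the resummed form `Δ_{1_Λ}` (`regionLaw blk Δ ℱ X Λ = fieldLaw blk Δ_{1_Λ} ℱ X`, p25's `prec_interp_corner_posDef`).
[cite: BalabanImbrieJaffe1988, p.309 (Sect. 5.14); (5.14.3) p.309] -/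
theorem slotFields_L1_mod_regionLaw (hΔ : Δ.PosDef) (hp : 1 / 2 < p)
    (hmod : ∀ b ∈ B, ∃ ℓ₁ ℓ₂ : (α → ℝ) → ℝ, IsLinearMap ℝ ℓ₁ ∧ IsLinearMap ℝ ℓ₂ ∧
      ((∀ φ, Φ b φ = ℓ₁ φ) ∨ (∀ φ, Φ b φ = Real.sqrt (ℓ₁ φ ^ 2 + ℓ₂ φ ^ 2))))
    {c₀ : ℝ} (hc₀ : 0 < c₀) (hcb : ∀ b ∈ B, c₀ ≤ c b) (hek : 0 < ek) (X Λ : Finset I) :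
    ∀ i, 1 ≤ i → Tendsto (fun t => ∫ ω, |iteratedDeriv i
        (fun s => ∏ b ∈ slotB B Ys cube X, cutoff χ (c b * pLog p (s * ek)) (Φ b (ext blk X ω))) t| ∂(regionLaw blk Δ ℱ X Λ))
      (𝓝[>] (0 : ℝ)) (𝓝 0) :=
  slotFields_L1_mod blk (interpForm blk Δ (corner ℝ Λ)) ℱ X χ hp (prec_interp_corner_posDef blk Δ hΔ X Λ)
    (B := slotB B Ys cube X) (Φ := fun b : ↥B => Φ b) (c := fun b : ↥B => c b) (fun b _ => hmod b b.2) hc₀ (fun b _ => hcb b b.2) hek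

/-! ## §2 (5.14.5) on the model for linear-or-modulus slot fields -/

/-- **(5.14.5) ON THE MODEL FOR BOTH χ-SPECIES OF p. 308 — NO MEAN-FIELD CONDITION, ANY SOURCE `ℱ`**: p25's `BIJ88Eq5145CornerUrsell.eq5145_zG_linear` /
gen 12's `BIJ88Eq5145CornerNoncentred.eq5145_zG_linear'` with `hlin` WEAKENED to `hmod` (each slot field a linear functional — a component of
`(I−Q^{s*}Q)A^{(k)}` — or a modulus of two linear functionals — `|φ^{(k)}(x)|`): (5.13.4), (5.14.1), (5.14.2) at `t = 0` (per region, by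
`BIJ88EffectiveActionNoncentred308.effectiveAction_eq_pertP_add_remR_ursell_of_L1` fed with `slotFields_L1_mod_regionLaw`; the region's `z_t > 0` on
`(0,1]` is p25's `zG_fD_empty_pos`), *"z_F = (z_F/z)·z"*, `z > 0` ALL by name / proved; displayed per region: a located slot `s₀`, `hrem`
(`ℛ = Σ_X W₆′(X)`, display 4 p. 310), `h311` (p. 311).  `χ ≥ 0`, `p > 1/2`, `c_b ≥ c₀ > 0`, measurable bounded cube-local terms, cube-local slot
fields, `0 < e_k < e^{−1}`, `n̄+1` labels, `Δ ≻ 0` coupling abutting cubes only. [cite: BalabanImbrieJaffe1988, (5.14.5) p.312; (5.14.1)–(5.14.2) p.308; p.309] -/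
theorem eq5145_zG_mod (hΔadj : ∀ x y, blk x ≠ blk y → ¬ adj (blk x) (blk y) → Δ x y = 0) (hΔ : Δ.PosDef)
    (hχ : ∀ x, 0 ≤ χ.χ₁ x) (hp : 1 / 2 < p)
    (hmod : ∀ b ∈ B, ∃ ℓ₁ ℓ₂ : (α → ℝ) → ℝ, IsLinearMap ℝ ℓ₁ ∧ IsLinearMap ℝ ℓ₂ ∧
      ((∀ φ, Φ b φ = ℓ₁ φ) ∨ (∀ φ, Φ b φ = Real.sqrt (ℓ₁ φ ^ 2 + ℓ₂ φ ^ 2))))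
    {c₀ : ℝ} (hc₀ : 0 < c₀) (hcb : ∀ b ∈ B, c₀ ≤ c b) (hV : ∀ Y ∈ Ys, Measurable (V Y)) {KY : υ → ℝ} (hK : ∀ Y ∈ Ys, ∀ φ, |V Y φ| ≤ KY Y)
    (hek : 0 < ek) (hek1 : ek < Real.exp (-1))
    (hΦloc : ∀ b : B, ∀ φ ψ : α → ℝ, (∀ x, blk x = cube (Sum.inl b) → φ x = ψ x) → Φ b φ = Φ b ψ)
    (hVloc : ∀ Y : Ys, ∀ φ ψ : α → ℝ, (∀ x, blk x = cube (Sum.inr Y) → φ x = ψ x) → V Y φ = V Y ψ)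
    (F : I → (α → ℝ) → ℝ) (hFloc : ∀ i (φ ψ : α → ℝ), (∀ x, blk x = i → φ x = ψ x) → F i φ = F i ψ)
    {αL : Type*} [Fintype αL] [DecidableEq αL] {nbar : ℕ} (hα : Fintype.card αL = nbar + 1)
    (W Bl : Finset I) {Xt : Type*} (𝒳 : Finset Xt) (Vconst PL : ℝ) (W6p W6pp : Finset (Finset I) → Xt → ℝ)
    (s₀ : (ρ : Finset (Finset I)) → ↥(slotB B Ys cube (lam12 W ρ)) ⊕ ↥(slotY B Ys cube (lam12 W ρ)))
    (hrem : ∀ ρ ∈ (outer W Bl).filter (IsAdmissible adj),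
      (nbar + 1 : ℝ) * remR (fun t => ∑ γ' : αL → ↥(slotB B Ys cube (lam12 W ρ)) ⊕ ↥(slotY B Ys cube (lam12 W ρ)),
        ursellOf (fun K' => slotMoment χ p ek (slotB B Ys cube (lam12 W ρ)) (fun b ω => Φ b (ext blk (lam12 W ρ) ω))
          (fun b => c b) (slotY B Ys cube (lam12 W ρ)) (fun Y ω => V Y (ext blk (lam12 W ρ) ω))
          (regionLaw blk Δ ℱ (lam12 W ρ) (lam12' adj W ρ)) t K' γ') univ) nbar = ∑ X ∈ 𝒳, W6p ρ X)
    (h311 : ∀ ρ ∈ (outer W Bl).filter (IsAdmissible adj),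
      Vconst + pertP (fun t => Real.log (ztIn blk Δ ℱ χ p ek B Φ c Ys V cube (lam12 W ρ) (lam12' adj W ρ) t)) nbar =
        PL + ∑ X ∈ 𝒳, W6pp ρ X) :
    Real.exp (-Vconst) * expect blk Δ ℱ (fun i φ => fD (uD χ p ek B Φ c Ys V 1) cube γ ∅ i φ * F i φ) W (corner ℝ W) =
      ∑ ρ ∈ (outer W Bl).filter (IsAdmissible adj),
        (∏ X ∈ ρ, g1 adj (zG blk Δ ℱ (fun i φ => fD (uD χ p ek B Φ c Ys V 1) cube γ ∅ i φ * F i φ)) X) *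
          (zG blk Δ ℱ (fun i φ => fD (uD χ p ek B Φ c Ys V 1) cube γ ∅ i φ * F i φ) (lam12 W ρ) (lam12' adj W ρ) /
              zG blk Δ ℱ (fD (uD χ p ek B Φ c Ys V 1) cube γ ∅) (lam12 W ρ) (lam12' adj W ρ) *
            Real.exp (-PL - ∑ X ∈ 𝒳, (W6p ρ X + W6pp ρ X))) := by
  have hcz : ∀ b ∈ B, Continuous (Φ b) ∧ Φ b 0 = 0 := fun b hb => by
    obtain ⟨ℓ₁, ℓ₂, h₁, h₂, h⟩ := hmod b hb
    exact continuous_and_zero_of_mod h₁ h₂ h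
  refine eq5145_zG blk Δ ℱ adj χ cube γ hΔadj hΔ hχ (by linarith) (fun b hb => (hcz b hb).1) (fun b hb => (hcz b hb).2) hc₀ hcb hV hK
    hek hek1.le hΦloc hVloc F hFloc W Bl 𝒳 Vconst PL
    (fun ρ => pertP (fun t => Real.log (ztIn blk Δ ℱ χ p ek B Φ c Ys V cube (lam12 W ρ) (lam12' adj W ρ) t)) nbar)
    (fun ρ => (nbar + 1 : ℝ) * remR (fun t => ∑ γ' : αL → ↥(slotB B Ys cube (lam12 W ρ)) ⊕ ↥(slotY B Ys cube (lam12 W ρ)),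
        ursellOf (fun K' => slotMoment χ p ek (slotB B Ys cube (lam12 W ρ)) (fun b ω => Φ b (ext blk (lam12 W ρ) ω))
          (fun b => c b) (slotY B Ys cube (lam12 W ρ)) (fun Y ω => V Y (ext blk (lam12 W ρ) ω))
          (regionLaw blk Δ ℱ (lam12 W ρ) (lam12' adj W ρ)) t K' γ') univ) nbar)
    W6p W6pp (fun ρ hρ => ?_) hrem h311
  -- (5.14.1)–(5.14.2) at `t = 0` for the region's `z_t`, by name from the p. 309 `L¹` input, NO centring, NO Gaussianity of the slot fields
  haveI := isProbabilityMeasure_regionLaw blk Δ ℱ hΔ (lam12 W ρ) (lam12' adj W ρ)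
  have hΦ' : ∀ b ∈ slotB B Ys cube (lam12 W ρ), Measurable fun ω : {x : α // blk x ∈ lam12 W ρ} → ℝ => Φ b (ext blk (lam12 W ρ) ω) :=
    fun b _ => ((hcz b b.2).1.comp (continuous_ext blk (lam12 W ρ))).measurable
  have hV' : ∀ Y ∈ slotY B Ys cube (lam12 W ρ), Measurable fun ω : {x : α // blk x ∈ lam12 W ρ} → ℝ => V Y (ext blk (lam12 W ρ) ω) :=
    fun Y _ => (hV Y Y.2).comp (measurable_ext blk (lam12 W ρ))
  have hzpos : ∀ t ∈ Set.Ioc (0 : ℝ) 1, 0 < ztIn blk Δ ℱ χ p ek B Φ c Ys V cube (lam12 W ρ) (lam12' adj W ρ) t := fun t ht => by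
    rw [← zG_fD_empty_eq_ztIn blk Δ ℱ χ (p := p) (ek := ek) (B := B) (Φ := Φ) (c := c) (Ys := Ys) (V := V) cube γ t]
    exact zG_fD_empty_pos blk Δ ℱ χ p ek B Φ c Ys V cube γ hχ (by linarith) hΔ (fun b hb => (hcz b hb).1) (fun b hb => (hcz b hb).2)
      hc₀ hcb hV hK hek ht.1 (BIJ88ZtPositivity308.mul_le_exp_neg_one_of_Ioc hek hek1.le ht) _ _
  have hL1 := slotFields_L1_mod_regionLaw blk Δ ℱ χ (Ys := Ys) cube hΔ hp hmod hc₀ hcb hek (lam12 W ρ) (lam12' adj W ρ)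
  have h14 := (effectiveAction_eq_pertP_add_remR_ursell_of_L1 χ (by linarith) (regionLaw blk Δ ℱ (lam12 W ρ) (lam12' adj W ρ))
    (B := slotB B Ys cube (lam12 W ρ)) (Φ := fun b ω => Φ b (ext blk (lam12 W ρ) ω)) (c := fun b => c b)
    (Ys := slotY B Ys cube (lam12 W ρ)) (V := fun Y ω => V Y (ext blk (lam12 W ρ) ω)) hΦ' hc₀
    (fun b _ => hcb b b.2) hV' (KY := fun Y => KY Y) (fun Y _ ω => hK Y Y.2 _) hek hek1 hzpos hL1 hα (s₀ ρ)).1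
  rw [zG_fD_empty_eq_ztIn]
  exact h14

/-- **(5.14.5) ON THE MODEL FOR BOTH χ-SPECIES, REMAINDER AS THE CONNECTED-GRAPH SERIES OF DISPLAY 3 MODULO THE LEAF (5.14.4) — NO MEAN-FIELD
CONDITION**: gen 12's `BIJ88Eq5145CornerNoncentred.eq5145_zG_linear_Tsum_of_ineq5144'` with `hlin` WEAKENED to `hmod`: per region `Λ₁₂` at
`1_{Λ₁₂′}`, `hlogz` DISCHARGED by `BIJ88GaussShellModulus309.effectiveAction_fieldLaw_eq_pertP_add_remR_Tsum_of_ineq5144_mod` for the located slot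
data (`slotB`, `slotY`, `cubeIn`) and the resummed form `Δ_{1_{Λ₁₂′}}`; displayed per region: `s₀`, THE LEAF (5.14.4) for the prime-dropped
activities of every assignment at every `t ∈ (0,1]` (`h5144`, gen 5's regime), `hrem` (display 4: `(n̄+1)·remR(Σ_γ T) = Σ_X W₆′(X)`) and `h311`.
[cite: BalabanImbrieJaffe1988, (5.14.5) p.312; (5.14.2) p.308; p.310 displays 3–4; (5.14.4) p.309] -/
theorem eq5145_zG_mod_Tsum_of_ineq5144 {nbr : I → Finset I} {D : ℕ} {θ β' : ℝ} (hR : ∀ x y, adj x y → adj y x)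
    (hD : ∀ x, (nbr x).card ≤ D) (hnbr : ∀ x y, adj x y → y ∈ nbr x) (hθ0 : 0 < θ) (hθ1 : θ ≤ 1) (hβ : 0 ≤ β')
    (hsmall : 16 * ((D : ℝ) + 1) ^ 2 * (θ ^ (β' / 2) * Real.exp 2) ≤ 1)
    (hΔadj : ∀ x y, blk x ≠ blk y → ¬ adj (blk x) (blk y) → Δ x y = 0) (hΔ : Δ.PosDef)
    (hχ : ∀ x, 0 ≤ χ.χ₁ x) (hp : 1 / 2 < p)
    (hmod : ∀ b ∈ B, ∃ ℓ₁ ℓ₂ : (α → ℝ) → ℝ, IsLinearMap ℝ ℓ₁ ∧ IsLinearMap ℝ ℓ₂ ∧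
      ((∀ φ, Φ b φ = ℓ₁ φ) ∨ (∀ φ, Φ b φ = Real.sqrt (ℓ₁ φ ^ 2 + ℓ₂ φ ^ 2))))
    {c₀ : ℝ} (hc₀ : 0 < c₀) (hcb : ∀ b ∈ B, c₀ ≤ c b) (hV : ∀ Y ∈ Ys, Measurable (V Y)) {KY : υ → ℝ} (hK : ∀ Y ∈ Ys, ∀ φ, |V Y φ| ≤ KY Y)
    (hek : 0 < ek) (hek1 : ek < Real.exp (-1))
    (hΦloc : ∀ b : B, ∀ φ ψ : α → ℝ, (∀ x, blk x = cube (Sum.inl b) → φ x = ψ x) → Φ b φ = Φ b ψ)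
    (hVloc : ∀ Y : Ys, ∀ φ ψ : α → ℝ, (∀ x, blk x = cube (Sum.inr Y) → φ x = ψ x) → V Y φ = V Y ψ)
    (F : I → (α → ℝ) → ℝ) (hFloc : ∀ i (φ ψ : α → ℝ), (∀ x, blk x = i → φ x = ψ x) → F i φ = F i ψ)
    {L' : Type} [Fintype L'] [DecidableEq L'] {nbar : ℕ} (hL : Fintype.card L' = nbar + 1)
    (W Bl : Finset I) {Xt : Type*} (𝒳 : Finset Xt) (Vconst PL : ℝ) (W6p W6pp : Finset (Finset I) → Xt → ℝ)
    (s₀ : (ρ : Finset (Finset I)) → ↥(slotB B Ys cube (lam12 W ρ)) ⊕ ↥(slotY B Ys cube (lam12 W ρ)))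
    (h5144 : ∀ ρ ∈ (outer W Bl).filter (IsAdmissible adj), ∀ t ∈ Set.Ioc (0 : ℝ) 1,
      ∀ γ' : L' → ↥(slotB B Ys cube (lam12 W ρ)) ⊕ ↥(slotY B Ys cube (lam12 W ρ)),
      Ineq5144 (cubeSys I) (Finset L')
        (prime (g3 adj fun H' => zG blk (interpForm blk Δ (corner ℝ (lam12' adj W ρ))) ℱ
          (fD (uD χ p ek (slotB B Ys cube (lam12 W ρ)) (fun b : ↥B => Φ b) (fun b : ↥B => c b) (slotY B Ys cube (lam12 W ρ))
            (fun Y : ↥Ys => V Y) t) (cubeIn cube (lam12 W ρ)) γ' H')))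
        Finset.card (fun H (X' : Finset I) => (X' \ H.image (cubeIn cube (lam12 W ρ) ∘ γ')).card) θ β')
    (hrem : ∀ ρ ∈ (outer W Bl).filter (IsAdmissible adj),
      (nbar + 1 : ℝ) * remR (fun t => ∑ γ' : L' → ↥(slotB B Ys cube (lam12 W ρ)) ⊕ ↥(slotY B Ys cube (lam12 W ρ)),
        Tsum ((polysOf (lam12 W ρ)).image (cvsupp adj (lam12 W ρ))) (locv (cubeIn cube (lam12 W ρ) ∘ γ'))
          (wv (prime (g3 adj fun H' => zG blk (interpForm blk Δ (corner ℝ (lam12' adj W ρ))) ℱ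
            (fD (uD χ p ek (slotB B Ys cube (lam12 W ρ)) (fun b : ↥B => Φ b) (fun b : ↥B => c b) (slotY B Ys cube (lam12 W ρ))
              (fun Y : ↥Ys => V Y) t) (cubeIn cube (lam12 W ρ)) γ' H')))) univ) nbar = ∑ X' ∈ 𝒳, W6p ρ X')
    (h311 : ∀ ρ ∈ (outer W Bl).filter (IsAdmissible adj),
      Vconst + pertP (fun t => Real.log (ztIn blk Δ ℱ χ p ek B Φ c Ys V cube (lam12 W ρ) (lam12' adj W ρ) t)) nbar =
        PL + ∑ X' ∈ 𝒳, W6pp ρ X') :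
    Real.exp (-Vconst) * expect blk Δ ℱ (fun i φ => fD (uD χ p ek B Φ c Ys V 1) cube γ ∅ i φ * F i φ) W (corner ℝ W) =
      ∑ ρ ∈ (outer W Bl).filter (IsAdmissible adj),
        (∏ X ∈ ρ, g1 adj (zG blk Δ ℱ (fun i φ => fD (uD χ p ek B Φ c Ys V 1) cube γ ∅ i φ * F i φ)) X) *
          (zG blk Δ ℱ (fun i φ => fD (uD χ p ek B Φ c Ys V 1) cube γ ∅ i φ * F i φ) (lam12 W ρ) (lam12' adj W ρ) /
              zG blk Δ ℱ (fD (uD χ p ek B Φ c Ys V 1) cube γ ∅) (lam12 W ρ) (lam12' adj W ρ) *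
            Real.exp (-PL - ∑ X' ∈ 𝒳, (W6p ρ X' + W6pp ρ X'))) := by
  have hcz : ∀ b ∈ B, Continuous (Φ b) ∧ Φ b 0 = 0 := fun b hb => by
    obtain ⟨ℓ₁, ℓ₂, h₁, h₂, h⟩ := hmod b hb
    exact continuous_and_zero_of_mod h₁ h₂ h
  refine eq5145_zG blk Δ ℱ adj χ cube γ hΔadj hΔ hχ (by linarith) (fun b hb => (hcz b hb).1) (fun b hb => (hcz b hb).2) hc₀ hcb hV hK
    hek hek1.le hΦloc hVloc F hFloc W Bl 𝒳 Vconst PL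
    (fun ρ => pertP (fun t => Real.log (ztIn blk Δ ℱ χ p ek B Φ c Ys V cube (lam12 W ρ) (lam12' adj W ρ) t)) nbar)
    (fun ρ => (nbar + 1 : ℝ) * remR (fun t => ∑ γ' : L' → ↥(slotB B Ys cube (lam12 W ρ)) ⊕ ↥(slotY B Ys cube (lam12 W ρ)),
        Tsum ((polysOf (lam12 W ρ)).image (cvsupp adj (lam12 W ρ))) (locv (cubeIn cube (lam12 W ρ) ∘ γ'))
          (wv (prime (g3 adj fun H' => zG blk (interpForm blk Δ (corner ℝ (lam12' adj W ρ))) ℱ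
            (fD (uD χ p ek (slotB B Ys cube (lam12 W ρ)) (fun b : ↥B => Φ b) (fun b : ↥B => c b) (slotY B Ys cube (lam12 W ρ))
              (fun Y : ↥Ys => V Y) t) (cubeIn cube (lam12 W ρ)) γ' H')))) univ) nbar)
    W6p W6pp (fun ρ hρ => ?_) hrem h311
  -- gen 12's `hmod` model theorem for the located slot data of the region `Λ₁₂ = lam12 W ρ` and the form `Δ_{1_{Λ₁₂′}}`
  have hPD := prec_interp_corner_posDef blk Δ hΔ (lam12 W ρ) (lam12' adj W ρ)
  have h14 := (effectiveAction_fieldLaw_eq_pertP_add_remR_Tsum_of_ineq5144_mod blk (interpForm blk Δ (corner ℝ (lam12' adj W ρ))) ℱ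
    (lam12 W ρ) χ adj (B := slotB B Ys cube (lam12 W ρ)) (Φ := fun b : ↥B => Φ b) (c := fun b : ↥B => c b)
    (Ys := slotY B Ys cube (lam12 W ρ)) (V := fun Y : ↥Ys => V Y) (cubeIn cube (lam12 W ρ)) hR hD hnbr hθ0 hθ1 hβ hsmall hχ hp
    (interpForm_abutting blk Δ adj hΔadj (lam12' adj W ρ)) hPD (cubeIn_mem cube (lam12 W ρ)) (fun b φ ψ h => hΦloc b.1 φ ψ h)
    (fun Y φ ψ h => hVloc Y.1 φ ψ h) (fun b _ => hmod b b.2) hc₀ (fun b _ => hcb b b.2) (fun Y _ => hV Y Y.2)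
    (KY := fun Y => KY Y) (fun Y _ φ => hK Y Y.2 φ) hek hek1 hL (s₀ ρ) (fun _ => s₀ ρ) (h5144 ρ hρ)).1
  have hbr : ∀ t, ztIn blk Δ ℱ χ p ek B Φ c Ys V cube (lam12 W ρ) (lam12' adj W ρ) t = _ :=
    fun t => ztIn_eq_zG_located blk Δ ℱ χ cube (lam12 W ρ) (lam12' adj W ρ) (fun _ : L' => s₀ ρ) t
  rw [zG_fD_empty_eq_ztIn]
  simp only [hbr]
  exact h14

/-- **(5.14.5) ON THE MODEL FOR BOTH χ-SPECIES OF p. 308, WITH `ℛ_k(Λ₁₂)` ITSELF IN THE EXPONENT, MODULO THE LEAF — THE ROW'S HEAD THEOREM WITH NO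
LINEARITY HYPOTHESIS ON THE SLOT FIELDS**: gen 12's `BIJ88Eq5145CornerNoncentred.eq5145_zG_linear_remR_of_ineq5144'` (`exp(−𝒫^L − Σ_X W₆″(X) −
ℛ_k(Λ₁₂))`, `ℛ_k(Λ₁₂) := (n̄+1)·remR(t ↦ Σ_γ T_{γ,t})`, display 4 read as the definition of the `W₆′` sum) with `hlin` WEAKENED to `hmod`: each
slot field `Φ_b` a linear functional (a component of `(I−Q^{s*}Q)A^{(k)}`) OR a modulus of two linear functionals (`|φ^{(k)}(x)| = √(Re²+Im²)`,
(5.2.1) p. 278), every source `ℱ`, no centring; displayed per region ONLY a located slot `s₀`, the leaf (5.14.4) `h5144` and p. 311 `h311`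
(`𝒳` any index set with a member `X₀`). [cite: BalabanImbrieJaffe1988, (5.14.5) p.312; (5.14.2) p.308; p.310 displays 3–4; (5.14.4) p.309; (5.2.1) p.278] -/
theorem eq5145_zG_mod_remR_of_ineq5144 {nbr : I → Finset I} {D : ℕ} {θ β' : ℝ} (hR : ∀ x y, adj x y → adj y x)
    (hD : ∀ x, (nbr x).card ≤ D) (hnbr : ∀ x y, adj x y → y ∈ nbr x) (hθ0 : 0 < θ) (hθ1 : θ ≤ 1) (hβ : 0 ≤ β')
    (hsmall : 16 * ((D : ℝ) + 1) ^ 2 * (θ ^ (β' / 2) * Real.exp 2) ≤ 1)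
    (hΔadj : ∀ x y, blk x ≠ blk y → ¬ adj (blk x) (blk y) → Δ x y = 0) (hΔ : Δ.PosDef)
    (hχ : ∀ x, 0 ≤ χ.χ₁ x) (hp : 1 / 2 < p)
    (hmod : ∀ b ∈ B, ∃ ℓ₁ ℓ₂ : (α → ℝ) → ℝ, IsLinearMap ℝ ℓ₁ ∧ IsLinearMap ℝ ℓ₂ ∧
      ((∀ φ, Φ b φ = ℓ₁ φ) ∨ (∀ φ, Φ b φ = Real.sqrt (ℓ₁ φ ^ 2 + ℓ₂ φ ^ 2))))
    {c₀ : ℝ} (hc₀ : 0 < c₀) (hcb : ∀ b ∈ B, c₀ ≤ c b) (hV : ∀ Y ∈ Ys, Measurable (V Y)) {KY : υ → ℝ} (hK : ∀ Y ∈ Ys, ∀ φ, |V Y φ| ≤ KY Y)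
    (hek : 0 < ek) (hek1 : ek < Real.exp (-1))
    (hΦloc : ∀ b : B, ∀ φ ψ : α → ℝ, (∀ x, blk x = cube (Sum.inl b) → φ x = ψ x) → Φ b φ = Φ b ψ)
    (hVloc : ∀ Y : Ys, ∀ φ ψ : α → ℝ, (∀ x, blk x = cube (Sum.inr Y) → φ x = ψ x) → V Y φ = V Y ψ)
    (F : I → (α → ℝ) → ℝ) (hFloc : ∀ i (φ ψ : α → ℝ), (∀ x, blk x = i → φ x = ψ x) → F i φ = F i ψ)
    {L' : Type} [Fintype L'] [DecidableEq L'] {nbar : ℕ} (hL : Fintype.card L' = nbar + 1)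
    (W Bl : Finset I) {Xt : Type*} [DecidableEq Xt] (𝒳 : Finset Xt) {X₀ : Xt} (hX₀ : X₀ ∈ 𝒳) (Vconst PL : ℝ)
    (W6pp : Finset (Finset I) → Xt → ℝ)
    (s₀ : (ρ : Finset (Finset I)) → ↥(slotB B Ys cube (lam12 W ρ)) ⊕ ↥(slotY B Ys cube (lam12 W ρ)))
    (h5144 : ∀ ρ ∈ (outer W Bl).filter (IsAdmissible adj), ∀ t ∈ Set.Ioc (0 : ℝ) 1,
      ∀ γ' : L' → ↥(slotB B Ys cube (lam12 W ρ)) ⊕ ↥(slotY B Ys cube (lam12 W ρ)),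
      Ineq5144 (cubeSys I) (Finset L')
        (prime (g3 adj fun H' => zG blk (interpForm blk Δ (corner ℝ (lam12' adj W ρ))) ℱ
          (fD (uD χ p ek (slotB B Ys cube (lam12 W ρ)) (fun b : ↥B => Φ b) (fun b : ↥B => c b) (slotY B Ys cube (lam12 W ρ))
            (fun Y : ↥Ys => V Y) t) (cubeIn cube (lam12 W ρ)) γ' H')))
        Finset.card (fun H (X' : Finset I) => (X' \ H.image (cubeIn cube (lam12 W ρ) ∘ γ')).card) θ β')
    (h311 : ∀ ρ ∈ (outer W Bl).filter (IsAdmissible adj),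
      Vconst + pertP (fun t => Real.log (ztIn blk Δ ℱ χ p ek B Φ c Ys V cube (lam12 W ρ) (lam12' adj W ρ) t)) nbar =
        PL + ∑ X' ∈ 𝒳, W6pp ρ X') :
    Real.exp (-Vconst) * expect blk Δ ℱ (fun i φ => fD (uD χ p ek B Φ c Ys V 1) cube γ ∅ i φ * F i φ) W (corner ℝ W) =
      ∑ ρ ∈ (outer W Bl).filter (IsAdmissible adj),
        (∏ X ∈ ρ, g1 adj (zG blk Δ ℱ (fun i φ => fD (uD χ p ek B Φ c Ys V 1) cube γ ∅ i φ * F i φ)) X) *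
          (zG blk Δ ℱ (fun i φ => fD (uD χ p ek B Φ c Ys V 1) cube γ ∅ i φ * F i φ) (lam12 W ρ) (lam12' adj W ρ) /
              zG blk Δ ℱ (fD (uD χ p ek B Φ c Ys V 1) cube γ ∅) (lam12 W ρ) (lam12' adj W ρ) *
            Real.exp (-PL - ∑ X' ∈ 𝒳, W6pp ρ X' -
              (nbar + 1 : ℝ) * remR (fun t => ∑ γ' : L' → ↥(slotB B Ys cube (lam12 W ρ)) ⊕ ↥(slotY B Ys cube (lam12 W ρ)),
                Tsum ((polysOf (lam12 W ρ)).image (cvsupp adj (lam12 W ρ))) (locv (cubeIn cube (lam12 W ρ) ∘ γ'))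
                  (wv (prime (g3 adj fun H' => zG blk (interpForm blk Δ (corner ℝ (lam12' adj W ρ))) ℱ
                    (fD (uD χ p ek (slotB B Ys cube (lam12 W ρ)) (fun b : ↥B => Φ b) (fun b : ↥B => c b)
                      (slotY B Ys cube (lam12 W ρ)) (fun Y : ↥Ys => V Y) t) (cubeIn cube (lam12 W ρ)) γ' H')))) univ) nbar)) := by
  have h := eq5145_zG_mod_Tsum_of_ineq5144 blk Δ ℱ adj χ cube γ hR hD hnbr hθ0 hθ1 hβ hsmall hΔadj hΔ hχ hp hmod hc₀ hcb hV hK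
    hek hek1 hΦloc hVloc F hFloc hL W Bl 𝒳 Vconst PL
    (fun ρ X' => if X' = X₀ then (nbar + 1 : ℝ) * remR (fun t => ∑ γ' : L' → ↥(slotB B Ys cube (lam12 W ρ)) ⊕ ↥(slotY B Ys cube (lam12 W ρ)),
        Tsum ((polysOf (lam12 W ρ)).image (cvsupp adj (lam12 W ρ))) (locv (cubeIn cube (lam12 W ρ) ∘ γ'))
          (wv (prime (g3 adj fun H' => zG blk (interpForm blk Δ (corner ℝ (lam12' adj W ρ))) ℱ
            (fD (uD χ p ek (slotB B Ys cube (lam12 W ρ)) (fun b : ↥B => Φ b) (fun b : ↥B => c b)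
              (slotY B Ys cube (lam12 W ρ)) (fun Y : ↥Ys => V Y) t) (cubeIn cube (lam12 W ρ)) γ' H')))) univ) nbar else 0)
    W6pp s₀ h5144 (fun ρ _ => by rw [sum_ite_eq' 𝒳 X₀, if_pos hX₀]) h311
  simp only [sum_add_ite_eq 𝒳 hX₀] at h
  rw [h]
  refine sum_congr rfl fun ρ _ => ?_
  congr 2
  ring_nf

end Literature.MathematicalPhysics.QuantumFieldTheory.BalabanImbrieJaffe1984to88.BIJ88Eq5145CornerModulus

end
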